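import Summits.QuantumFields.BalabanUV.T4Continuum.Spine.NE7.Targets

/-!
# BalabanUVNodes ∕ node N19 (NE7) with N20 (NE7b) — THE AGE-CUT ROAD AT THE FINE KEY, TYPED END TO END: terms carrying a healed large-field component OLDER than
# the cut `n⋆(K)` go to the BAD class (NE7b pays their weight — first age-moment of the activity), the others are matched termwise at the geometric rate of their
# oldest component's BIRTH SCALE; at the half-age cut `n⋆(K) = K∕2` both budgets are summable ⇒ `HybridNE7`

Cell `pub-ymgap` (HUMAN RULING D-0062 Track A ∕ D-0149 width seats), WIDTH SEAT `pub-ymgap-dag-n19-w1` (node n19 = NE7, seat 1 of 3), generation g3,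
INTENT-6.  Route `Summits/QuantumFields/YangMills/Theses/BalabanUVNodes.lean`, key item K3⁷ `SpineGivenEndpointR13SepCoPH` (stmt-QuantumFields-20544; v4 stub 2 `stub_expansion13H`:
its N19′ conjunct `KeyedCoreEdgeHolderD4` AND its N20 conjunct `KeyedRelWeight`, with the cut dial `jc`); filed `--kind proof --supports … --as helper`.  COUNT-NEUTRAL.  THEOREMS ONLY
(0 `def`, 0 `sorry`).  ADDITIVE — imports the tree's `Spine/NE7/Targets` (`Core`, `sandwich_of_abs_log_sub_le`; through it `T4MatchingAssembly` (`HybridNE7`, `hybridNE7_noShell`),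
`T4WeightBudget` (`RelWeightBound`)) ONLY; modifies nothing.

WHY.  The companion `…N19FibreAveragingGain` (INTENT-5) typed the COARSE road to N19′'s slot for the old-large-field channel of the crux idea card `age-scale-convolution`
(evidence n°46∕n°47 on 20544): average the old components inside coarse classes, pay the MEAN `Σ_{j+n=K} u_j·a_n`.  At the FINE key of the spine reading of record (`crOfRecord₁₃V`:
full histories) no averaging is available, a term whose oldest healed component was born at scale `0` deviates by `u 0 = O(1)`, and `…N19HybridBeyondTarget` §6 shows an `O(1)` gap
on GOOD classes is fatal — so at the fine key those terms must be CUT into the bad class: the tree's design from the start (`T4WeightBudget.RelWeightBound`'s «terms carrying OLD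
PENDING large-field structure (older than `K − j⋆(K)`)», stub 2's per-tuple cut dial `jc`).  This file types that road end to end with the same displayed physics letters as the
coarse road: an AGE map on terms (`age K t τ ≤ K`, the age of the oldest healed large-field component, `0` = none), termwise two-run matching at the BIRTH-SCALE rate
`|log B − log A − c_K| ≤ u (K − age)` with `0 ≤ u j ≤ C·θ^j`, and in BOTH runs the age-`n` terms' weight fraction `≤ a n` (activity).  With a cut `n⋆ : ℕ → ℕ`:
* §1 [folklore] `sum_filter_ageCut_eq` (the bad class `{age > n⋆(K)}` decomposes by age over `Ioc (n⋆ K) K`) · `sum_filter_ageCut_le` (its weight `≤ (Σ_{n ∈ Ioc (n⋆ K) K} a n)·Σ_T`).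
* §2 [folklore] ★★ `relWeightBound_ageCut` — NE7b PRODUCED from the activity letters: `RelWeightBound l₀ T A B {age > n⋆} (K ↦ Σ_{n ∈ Ioc (n⋆ K) K} a n)` given `a ≥ 0`, that tail `< 1`
  (smallness — a displayed hypothesis) and SUMMABLE in `K`, weight fractions in both runs, non-negative terms.
* §3 [folklore] ★★ `core_ageCut` — NE7 proper on the kept terms: ages `≤ n⋆(K)` have birth scale `≥ K − n⋆(K)`, so `Core l₀ vol T {age > n⋆} A B (K ↦ C·θ^{K − n⋆ K}∕vol)` (`0 ≤ θ ≤ 1`,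
  `0 < vol`).
* §4 [folklore] ★★ `hybridNE7_ageCut` — the binder list at the fine key with zero shells: §2 + §3 + `Summable (K ↦ θ^{K − n⋆ K})` ⇒ `HybridNE7 l₀ vol T A B {age > n⋆} W 0 0 0 (C·θ^{K−n⋆K}∕vol)`
  (`T4MatchingAssembly.hybridNE7_noShell` BY NAME).
* §5 [folklore] THE HALF-AGE CUT `n⋆(K) = K ∕ 2`: `card_filter_halfWindow_le` (a fixed age `n` is cut-relevant at `≤ n` levels `K ∈ [n, 2n)`) · ★ `summable_halfAgeTail` (FUBINI: the NE7b
  budget `Σ_K Σ_{K∕2 < n ≤ K} a n ≤ Σ_n n·a n` — the FIRST AGE-MOMENT of the activity, `Summable (n ↦ (n+1)·a n)` = the card's `SummableTransport 1 a`) · `summable_pow_sub_half`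
  (`Σ_K θ^{K − K∕2} < ∞`, comparison with `(√θ)^K`) · ★★ `hybridNE7_halfAgeCut` — EVERYTHING ASSEMBLED: activity with summable first moment + tail `< 1` + geometric birth-scale matching +
  positive terms ⇒ `HybridNE7` at the fine key with bad class `{age > K∕2}`.
* §6 [folklore] ★★ `hybridNE7_ageCut_eventually` · ★★ `hybridNE7_halfAgeCut_eventually` — THE SMALLNESS HYPOTHESIS REMOVED: a summable tail is eventually `< 1`; below that level the bad
  class is emptied (`T4WeightBudget.relWeightBound_of_eventually` BY NAME) and all terms are matched at the finite radius `C`; every remaining hypothesis is qualitative.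
READINGS (for the planner ∕ the card's owners; located, nothing proposed).  (i) The two roads to stub 2's N19′ conjunct for the old-large-field channel now both stand typed with the
SAME three physics letters (age map, activity as weight fraction, birth-scale matching `u`): COARSE key + averaging (INTENT-5: zeroth age-moment `Σ a_n`, bounded worst case `R`, NO
cut, N20 idle) versus FINE key + age cut (this file: first age-moment `Σ n·a_n`, NO worst-case bound needed, N20's `RelWeightBound` carries the old components) — Bałaban's activity
`exp(−(A·log(x₀+bn))^{2p₀})` has ALL moments (`…N19AgeScaleTransportBudget.summable_succ_pow_mul_balabanActivity`), so either budget is met once the letters are.  (ii) On the fine road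
the cut dial IS stub 2's `jc` read as an AGE threshold; the half-age choice is one admissible policy (any `n⋆` with `K − n⋆(K) → ∞` geometrically-summably and `Σ_K Σ_{n>n⋆(K)} a_n < ∞`
works — §4 is stated for a general `n⋆`).  (iii) Neither road proves a letter: `hdev`, `hwtA∕hwtB` are exactly the card's unprinted K1∕K2 content.

HONEST FRAMING.  Finite-sum ∕ series bookkeeping [folklore] over the tree's SHAPES; the age map, the activity, the birth-scale matching, positivity occur as HYPOTHESES only; nothing
of Bałaban's is asserted or instantiated; no estimate of the programme is proved.  NE7 ∕ NE7b NOT PRINTED as two-run statements for d = 4 ([King1986] (3.10)–(3.13) is the d = 2, 3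
TEMPLATE of the small-field ∕ large-field split, context only) ∕ NOT proved; N19 ∕ N20 NOT discharged; K3⁷ OPEN, not claimed; counts UNMOVED (typed 28∕28 · discharged 5∕27, A 5∕28).
Everything below is PROVED (0 `sorry`, 0 named facts, standard axioms); no decl carries a cite tag.  One finite four-torus programme at fixed ε — NOT ℝ⁴, NOT infinite volume, NOT OS,
NOT a mass gap, NOT the Clay problem (R4 closes the conditional finite-𝕋⁴ rung `BalabanLadder.UV` only).
-/

noncomputable section

open Finset
open scoped BigOperators

namespace Summit.QuantumFields.YangMills.BalabanUVNodes.N19AgeCutRoad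

open Summit.QuantumFields.BalabanUV.T4Continuum.Spine.NE7 (Core sandwich_of_abs_log_sub_le)
open Literature.MathematicalPhysics.QuantumFieldTheory.Balaban1983to89
open T4WeightBudget (RelWeightBound)
open T4MatchingAssembly (HybridNE7 hybridNE7_noShell)

variable {ι : Type*}

/-! ## §1 The bad class `{age > n⋆(K)}` decomposes by age [folklore] -/

section Decompose
variable {TK : Finset ι} {ageK : ι → ℕ} {AK : ι → ℝ} {a : ℕ → ℝ} {K m : ℕ}

/-- The weight of the cut class `{τ ∈ T : m < age τ}` (ages `≤ K`) is the sum over the ages `n ∈ Ioc m K` of the age-`n` weights. [folklore] -/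
theorem sum_filter_ageCut_eq (hage : ∀ τ ∈ TK, ageK τ ≤ K) :
    ∑ τ ∈ TK.filter (fun τ => m < ageK τ), AK τ = ∑ n ∈ Ioc m K, ∑ τ ∈ TK.filter (fun τ => ageK τ = n), AK τ := by
  rw [← Finset.sum_fiberwise_of_maps_to (s := TK.filter (fun τ => m < ageK τ)) (t := Ioc m K) (g := ageK)
    (fun τ hτ => Finset.mem_Ioc.mpr ⟨(Finset.mem_filter.mp hτ).2, hage τ (Finset.mem_filter.mp hτ).1⟩)]
  refine Finset.sum_congr rfl fun n hn => Finset.sum_congr ?_ fun _ _ => rfl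
  ext τ
  simp only [Finset.mem_filter]
  constructor
  · rintro ⟨⟨hτ, _⟩, he⟩; exact ⟨hτ, he⟩
  · rintro ⟨hτ, he⟩; exact ⟨⟨hτ, he ▸ (Finset.mem_Ioc.mp hn).1⟩, he⟩

/-- … so if the age-`n` terms carry weight fraction `≤ a n` (`a ≥ 0`), the cut class carries fraction `≤ Σ_{n ∈ Ioc m K} a n`. [folklore] -/
theorem sum_filter_ageCut_le (hage : ∀ τ ∈ TK, ageK τ ≤ K)
    (hwt : ∀ n, ∑ τ ∈ TK.filter (fun τ => ageK τ = n), AK τ ≤ a n * ∑ τ ∈ TK, AK τ) :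
    ∑ τ ∈ TK.filter (fun τ => m < ageK τ), AK τ ≤ (∑ n ∈ Ioc m K, a n) * ∑ τ ∈ TK, AK τ := by
  rw [sum_filter_ageCut_eq hage, Finset.sum_mul]
  exact Finset.sum_le_sum fun n _ => hwt n

end Decompose

/-! ## §2 NE7b produced from the activity letters [folklore] -/

section Weight
variable {l₀ : ℝ} {T : ℕ → Finset ι} {A B : ℕ → ℝ → ι → ℝ} {age : ℕ → ℝ → ι → ℕ} {a : ℕ → ℝ} {nstar : ℕ → ℕ}

/-- **★★ NE7b FROM THE ACTIVITY** [folklore].  Non-negative terms with ages `≤ K`, in BOTH runs the age-`n` terms carrying weight fraction `≤ a n` (`a ≥ 0`), and a cut `n⋆` whose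
activity tail `W K := Σ_{n ∈ Ioc (n⋆ K) K} a n` is `< 1` for every `K` and SUMMABLE in `K` ⇒ `RelWeightBound l₀ T A B {age > n⋆} W` — the N20 conjunct at the fine key with the bad class
«oldest healed component older than the cut». -/
theorem relWeightBound_ageCut (ha0 : ∀ n, 0 ≤ a n) (hW1 : ∀ K, ∑ n ∈ Ioc (nstar K) K, a n < 1) (hWs : Summable fun K => ∑ n ∈ Ioc (nstar K) K, a n)
    (hage : ∀ (K : ℕ) (t : ℝ), |t| ≤ l₀ → ∀ τ ∈ T K, age K t τ ≤ K)
    (hwtA : ∀ (K : ℕ) (t : ℝ), |t| ≤ l₀ → ∀ n, ∑ τ ∈ (T K).filter (fun τ => age K t τ = n), A K t τ ≤ a n * ∑ τ ∈ T K, A K t τ)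
    (hwtB : ∀ (K : ℕ) (t : ℝ), |t| ≤ l₀ → ∀ n, ∑ τ ∈ (T K).filter (fun τ => age K t τ = n), B K t τ ≤ a n * ∑ τ ∈ T K, B K t τ) :
    RelWeightBound l₀ T A B (fun K t => (T K).filter fun τ => nstar K < age K t τ) (fun K => ∑ n ∈ Ioc (nstar K) K, a n) where
  bad_subset _ _ _ := Finset.filter_subset _ _
  nonneg _ := Finset.sum_nonneg fun n _ => ha0 n
  lt_one := hW1
  summable := hWs
  bad_left K t ht := sum_filter_ageCut_le (hage K t ht) (hwtA K t ht)
  bad_right K t ht := sum_filter_ageCut_le (hage K t ht) (hwtB K t ht)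

end Weight

/-! ## §3 NE7 proper on the kept terms: birth scale `≥ K − n⋆(K)` [folklore] -/

section CoreCut
variable [DecidableEq ι] {l₀ vol C θ : ℝ} {T : ℕ → Finset ι} {A B : ℕ → ℝ → ι → ℝ} {age : ℕ → ℝ → ι → ℕ} {u : ℕ → ℝ} {nstar : ℕ → ℕ}

/-- **★★ `Core` ON THE KEPT TERMS** [folklore].  Positive terms, for every `K` ONE constant `c_K` with termwise `|log B − log A − c_K| ≤ u (K − age)` (matching at the BIRTH-SCALE rate
of the term's oldest healed component), `u j ≤ C·θ^j` with `0 ≤ θ ≤ 1`, `0 < vol` ⇒ on the terms kept by the cut (`age ≤ n⋆ K`, birth scale `≥ K − n⋆ K`) the two runs are sandwiched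
at radius `C·θ^{K − n⋆ K}`: `Core l₀ vol T {age > n⋆} A B (K ↦ C·θ^{K − n⋆ K}∕vol)`. -/
theorem core_ageCut (hvol : 0 < vol) (hC : 0 ≤ C) (hθ : 0 ≤ θ) (hθ1 : θ ≤ 1) (hu : ∀ j, u j ≤ C * θ ^ j)
    (hA : ∀ (K : ℕ) (t : ℝ), |t| ≤ l₀ → ∀ τ ∈ T K, 0 < A K t τ) (hB : ∀ (K : ℕ) (t : ℝ), |t| ≤ l₀ → ∀ τ ∈ T K, 0 < B K t τ)
    (hdev : ∀ K : ℕ, ∃ c : ℝ, ∀ t : ℝ, |t| ≤ l₀ → ∀ τ ∈ T K, |Real.log (B K t τ) - Real.log (A K t τ) - c| ≤ u (K - age K t τ)) :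
    Core l₀ vol T (fun K t => (T K).filter fun τ => nstar K < age K t τ) A B (fun K => C * θ ^ (K - nstar K) / vol) := by
  intro K
  obtain ⟨c, hc⟩ := hdev K
  refine ⟨c, fun t ht τ hτ => ?_⟩
  obtain ⟨hτT, hτB⟩ := Finset.mem_sdiff.mp hτ
  have hage : age K t τ ≤ nstar K := not_lt.mp fun h => hτB (Finset.mem_filter.mpr ⟨hτT, h⟩)
  refine sandwich_of_abs_log_sub_le (hA K t ht τ hτT) (hB K t ht τ hτT) ?_
  rw [mul_div_cancel₀ _ hvol.ne']
  calc |Real.log (B K t τ) - Real.log (A K t τ) - c| ≤ u (K - age K t τ) := hc t ht τ hτT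
    _ ≤ C * θ ^ (K - age K t τ) := hu _
    _ ≤ C * θ ^ (K - nstar K) := mul_le_mul_of_nonneg_left (pow_le_pow_of_le_one hθ hθ1 (Nat.sub_le_sub_left hage K)) hC

end CoreCut

/-! ## §4 The binder list at the fine key with an age cut [folklore] -/

section Assemble
variable [DecidableEq ι] {l₀ vol C θ : ℝ} {T : ℕ → Finset ι} {A B : ℕ → ℝ → ι → ℝ} {age : ℕ → ℝ → ι → ℕ} {u a : ℕ → ℝ} {nstar : ℕ → ℕ}

/-- **★★ `HybridNE7` AT THE FINE KEY WITH AN AGE CUT** [folklore].  §2 (NE7b from the activity) + §3 (`Core` on the kept terms) + summability of `K ↦ θ^{K − n⋆ K}` ⇒ the hybrid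
binder list with bad class `{age > n⋆}`, weights `W K = Σ_{n ∈ Ioc (n⋆ K) K} a n`, ZERO shells, rate `C·θ^{K − n⋆ K}∕vol` (`T4MatchingAssembly.hybridNE7_noShell` BY NAME). -/
theorem hybridNE7_ageCut (hvol : 0 < vol) (hC : 0 ≤ C) (hθ : 0 ≤ θ) (hθ1 : θ ≤ 1) (hu : ∀ j, u j ≤ C * θ ^ j)
    (hgeo : Summable fun K : ℕ => θ ^ (K - nstar K))
    (ha0 : ∀ n, 0 ≤ a n) (hW1 : ∀ K, ∑ n ∈ Ioc (nstar K) K, a n < 1) (hWs : Summable fun K => ∑ n ∈ Ioc (nstar K) K, a n)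
    (hA : ∀ (K : ℕ) (t : ℝ), |t| ≤ l₀ → ∀ τ ∈ T K, 0 < A K t τ) (hB : ∀ (K : ℕ) (t : ℝ), |t| ≤ l₀ → ∀ τ ∈ T K, 0 < B K t τ)
    (hage : ∀ (K : ℕ) (t : ℝ), |t| ≤ l₀ → ∀ τ ∈ T K, age K t τ ≤ K)
    (hdev : ∀ K : ℕ, ∃ c : ℝ, ∀ t : ℝ, |t| ≤ l₀ → ∀ τ ∈ T K, |Real.log (B K t τ) - Real.log (A K t τ) - c| ≤ u (K - age K t τ))
    (hwtA : ∀ (K : ℕ) (t : ℝ), |t| ≤ l₀ → ∀ n, ∑ τ ∈ (T K).filter (fun τ => age K t τ = n), A K t τ ≤ a n * ∑ τ ∈ T K, A K t τ)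
    (hwtB : ∀ (K : ℕ) (t : ℝ), |t| ≤ l₀ → ∀ n, ∑ τ ∈ (T K).filter (fun τ => age K t τ = n), B K t τ ≤ a n * ∑ τ ∈ T K, B K t τ) :
    HybridNE7 l₀ vol T A B (fun K t => (T K).filter fun τ => nstar K < age K t τ) (fun K => ∑ n ∈ Ioc (nstar K) K, a n)
      (fun _ _ _ => 0) (fun _ _ _ => 0) (fun _ => 0) (fun K => C * θ ^ (K - nstar K) / vol) :=
  hybridNE7_noShell (relWeightBound_ageCut ha0 hW1 hWs hage hwtA hwtB) (fun K t ht τ hτ => (hA K t ht τ hτ).le) (fun K t ht τ hτ => (hB K t ht τ hτ).le)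
    ((hgeo.mul_left C).div_const vol |>.congr fun K => by ring) (core_ageCut hvol hC hθ hθ1 hu hA hB hdev)

end Assemble

/-! ## §5 The half-age cut `n⋆(K) = K ∕ 2`: both budgets are summable [folklore] -/

section HalfCut
variable {a : ℕ → ℝ} {θ : ℝ}

/-- A fixed age `n` lies in the cut window `(K∕2, K]` for at most `n` levels `K` (namely `n ≤ K < 2n`). [folklore] -/
theorem card_filter_halfWindow_le (N n : ℕ) : ((range N).filter fun K => K / 2 < n ∧ n ≤ K).card ≤ n := by
  calc ((range N).filter fun K => K / 2 < n ∧ n ≤ K).card ≤ (Ico n (2 * n)).card :=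
        Finset.card_le_card fun K hK => by
          obtain ⟨-, h1, h2⟩ := Finset.mem_filter.mp hK
          exact Finset.mem_Ico.mpr ⟨h2, by omega⟩
    _ = n := by rw [Nat.card_Ico]; omega

/-- **★ THE NE7b BUDGET OF THE HALF-AGE CUT IS THE FIRST AGE-MOMENT** [folklore] (Fubini on finite partial sums): for `a ≥ 0` with `Σ_n (n+1)·a n < ∞` (the card's `SummableTransport 1 a`),
`K ↦ Σ_{n ∈ Ioc (K∕2) K} a n` is summable — its partial sums are `≤ Σ_n n·a n`. -/
theorem summable_halfAgeTail (ha0 : ∀ n, 0 ≤ a n) (ha1 : Summable fun n : ℕ => ((n : ℝ) + 1) * a n) :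
    Summable fun K : ℕ => ∑ n ∈ Ioc (K / 2) K, a n := by
  refine summable_of_sum_range_le (c := ∑' n : ℕ, ((n : ℝ) + 1) * a n) (fun K => Finset.sum_nonneg fun n _ => ha0 n) fun N => ?_
  -- rewrite the window sums as indicator sums over `range N`, then swap
  have hwin : ∀ K ∈ range N, ∑ n ∈ Ioc (K / 2) K, a n = ∑ n ∈ range N, if K / 2 < n ∧ n ≤ K then a n else 0 := fun K hK => by
    rw [← Finset.sum_filter]
    refine Finset.sum_congr ?_ fun _ _ => rfl
    ext n
    simp only [Finset.mem_Ioc, Finset.mem_filter, Finset.mem_range]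
    constructor
    · rintro ⟨h1, h2⟩; exact ⟨lt_of_le_of_lt h2 (Finset.mem_range.mp hK), h1, h2⟩
    · rintro ⟨-, h1, h2⟩; exact ⟨h1, h2⟩
  rw [Finset.sum_congr rfl hwin, Finset.sum_comm]
  calc ∑ n ∈ range N, ∑ K ∈ range N, (if K / 2 < n ∧ n ≤ K then a n else 0)
      = ∑ n ∈ range N, (((range N).filter fun K => K / 2 < n ∧ n ≤ K).card : ℝ) * a n := by
        refine Finset.sum_congr rfl fun n _ => ?_
        rw [← Finset.sum_filter, Finset.sum_const, nsmul_eq_mul]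
    _ ≤ ∑ n ∈ range N, ((n : ℝ) + 1) * a n := Finset.sum_le_sum fun n _ =>
        mul_le_mul_of_nonneg_right (by exact_mod_cast (card_filter_halfWindow_le N n).trans (Nat.le_succ n)) (ha0 n)
    _ ≤ ∑' n : ℕ, ((n : ℝ) + 1) * a n := ha1.sum_le_tsum (range N) fun n _ => mul_nonneg (by positivity) (ha0 n)

/-- `Σ_K θ^{K − K∕2} < ∞` for `0 ≤ θ < 1` (comparison with the geometric series in `√θ`: `θ^{K − K∕2} ≤ (√θ)^K`). [folklore] -/
theorem summable_pow_sub_half (hθ : 0 ≤ θ) (hθ1 : θ < 1) : Summable fun K : ℕ => θ ^ (K - K / 2) := by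
  have hs0 : 0 ≤ Real.sqrt θ := Real.sqrt_nonneg θ
  have hs1 : Real.sqrt θ < 1 := (Real.sqrt_lt' one_pos).mpr (by simpa using hθ1)
  refine Summable.of_nonneg_of_le (fun K => pow_nonneg hθ _) (fun K => ?_) (summable_geometric_of_lt_one hs0 hs1)
  have hK : K ≤ 2 * (K - K / 2) := by omega
  calc θ ^ (K - K / 2) = Real.sqrt θ ^ (2 * (K - K / 2)) := by rw [pow_mul, Real.sq_sqrt hθ]
    _ ≤ Real.sqrt θ ^ K := pow_le_pow_of_le_one hs0 hs1.le hK

variable [DecidableEq ι] {l₀ vol C : ℝ} {T : ℕ → Finset ι} {A B : ℕ → ℝ → ι → ℝ} {age : ℕ → ℝ → ι → ℕ} {u : ℕ → ℝ}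

/-- **★★ THE HALF-AGE CUT, EVERYTHING ASSEMBLED** [folklore].  Positive terms with ages `≤ K`; termwise matching at the birth-scale rate `|log B − log A − c_K| ≤ u (K − age)`,
`u j ≤ C·θ^j`, `0 ≤ C`, `0 ≤ θ < 1`; in both runs the age-`n` weight fraction `≤ a n` with `a ≥ 0`, FIRST AGE-MOMENT summable (`Σ (n+1)·a n < ∞`) and tails `Σ_{K∕2 < n ≤ K} a n < 1`
(smallness); `0 < vol` ⇒ `HybridNE7 l₀ vol T A B {age > K∕2} (K ↦ Σ_{n ∈ Ioc (K∕2) K} a n) 0 0 0 (K ↦ C·θ^{K − K∕2}∕vol)` — N20's and N19′'s conjuncts at the fine key, jointly, for the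
old-large-field channel, from the three displayed letters. -/
theorem hybridNE7_halfAgeCut (hvol : 0 < vol) (hC : 0 ≤ C) (hθ : 0 ≤ θ) (hθ1 : θ < 1) (hu : ∀ j, u j ≤ C * θ ^ j)
    (ha0 : ∀ n, 0 ≤ a n) (ha1 : Summable fun n : ℕ => ((n : ℝ) + 1) * a n) (hW1 : ∀ K, ∑ n ∈ Ioc (K / 2) K, a n < 1)
    (hA : ∀ (K : ℕ) (t : ℝ), |t| ≤ l₀ → ∀ τ ∈ T K, 0 < A K t τ) (hB : ∀ (K : ℕ) (t : ℝ), |t| ≤ l₀ → ∀ τ ∈ T K, 0 < B K t τ)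
    (hage : ∀ (K : ℕ) (t : ℝ), |t| ≤ l₀ → ∀ τ ∈ T K, age K t τ ≤ K)
    (hdev : ∀ K : ℕ, ∃ c : ℝ, ∀ t : ℝ, |t| ≤ l₀ → ∀ τ ∈ T K, |Real.log (B K t τ) - Real.log (A K t τ) - c| ≤ u (K - age K t τ))
    (hwtA : ∀ (K : ℕ) (t : ℝ), |t| ≤ l₀ → ∀ n, ∑ τ ∈ (T K).filter (fun τ => age K t τ = n), A K t τ ≤ a n * ∑ τ ∈ T K, A K t τ)
    (hwtB : ∀ (K : ℕ) (t : ℝ), |t| ≤ l₀ → ∀ n, ∑ τ ∈ (T K).filter (fun τ => age K t τ = n), B K t τ ≤ a n * ∑ τ ∈ T K, B K t τ) :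
    HybridNE7 l₀ vol T A B (fun K t => (T K).filter fun τ => K / 2 < age K t τ) (fun K => ∑ n ∈ Ioc (K / 2) K, a n)
      (fun _ _ _ => 0) (fun _ _ _ => 0) (fun _ => 0) (fun K => C * θ ^ (K - K / 2) / vol) :=
  hybridNE7_ageCut (nstar := fun K => K / 2) hvol hC hθ hθ1.le hu (summable_pow_sub_half hθ hθ1) ha0 hW1 (summable_halfAgeTail ha0 ha1) hA hB hage hdev hwtA hwtB

end HalfCut

/-! ## §6 Without the smallness hypothesis: a summable tail is eventually `< 1`, early levels are matched whole [folklore] -/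

section Eventually
variable [DecidableEq ι] {l₀ vol C θ : ℝ} {T : ℕ → Finset ι} {A B : ℕ → ℝ → ι → ℝ} {age : ℕ → ℝ → ι → ℕ} {u a : ℕ → ℝ} {nstar : ℕ → ℕ}

/-- **★★ THE AGE CUT WITH NO SMALLNESS HYPOTHESIS** [folklore].  The tail `Σ_{n ∈ Ioc (n⋆ K) K} a n` being SUMMABLE in `K`, it tends to `0` and is `< 1` from some `K₀` on; below `K₀`
the bad class is EMPTIED (`T4WeightBudget.relWeightBound_of_eventually` BY NAME) and ALL terms are matched at the finite radius `C` (birth scale `≥ 0`, `θ ≤ 1`); from `K₀` on §2–§3 apply.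
Result: `∃ K₀, HybridNE7 …` with bad class `{age > n⋆}` from `K₀` on, weights the indicator of the tail, zero shells, rate `C·θ^{K − n⋆ K}∕vol` from `K₀` on and `C∕vol` before —
every hypothesis now QUALITATIVE (summabilities, geometric `u`, positivity). -/
theorem hybridNE7_ageCut_eventually (hvol : 0 < vol) (hC : 0 ≤ C) (hθ : 0 ≤ θ) (hθ1 : θ ≤ 1) (hu : ∀ j, u j ≤ C * θ ^ j)
    (hgeo : Summable fun K : ℕ => θ ^ (K - nstar K))
    (ha0 : ∀ n, 0 ≤ a n) (hWs : Summable fun K => ∑ n ∈ Ioc (nstar K) K, a n)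
    (hA : ∀ (K : ℕ) (t : ℝ), |t| ≤ l₀ → ∀ τ ∈ T K, 0 < A K t τ) (hB : ∀ (K : ℕ) (t : ℝ), |t| ≤ l₀ → ∀ τ ∈ T K, 0 < B K t τ)
    (hage : ∀ (K : ℕ) (t : ℝ), |t| ≤ l₀ → ∀ τ ∈ T K, age K t τ ≤ K)
    (hdev : ∀ K : ℕ, ∃ c : ℝ, ∀ t : ℝ, |t| ≤ l₀ → ∀ τ ∈ T K, |Real.log (B K t τ) - Real.log (A K t τ) - c| ≤ u (K - age K t τ))
    (hwtA : ∀ (K : ℕ) (t : ℝ), |t| ≤ l₀ → ∀ n, ∑ τ ∈ (T K).filter (fun τ => age K t τ = n), A K t τ ≤ a n * ∑ τ ∈ T K, A K t τ)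
    (hwtB : ∀ (K : ℕ) (t : ℝ), |t| ≤ l₀ → ∀ n, ∑ τ ∈ (T K).filter (fun τ => age K t τ = n), B K t τ ≤ a n * ∑ τ ∈ T K, B K t τ) :
    ∃ K₀ : ℕ, HybridNE7 l₀ vol T A B (fun K t => if K₀ ≤ K then (T K).filter (fun τ => nstar K < age K t τ) else ∅)
      (Set.indicator {K | K₀ ≤ K} fun K => ∑ n ∈ Ioc (nstar K) K, a n) (fun _ _ _ => 0) (fun _ _ _ => 0) (fun _ => 0)
      (fun K => if K₀ ≤ K then C * θ ^ (K - nstar K) / vol else C / vol) := by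
  obtain ⟨K₀, hK₀⟩ := Filter.eventually_atTop.mp (hWs.tendsto_atTop_zero.eventually (gt_mem_nhds one_pos))
  have hW := T4WeightBudget.relWeightBound_of_eventually (l₀ := l₀) (T := T) (A := A) (B := B) (K₀ := K₀)
    (Bad := fun K t => (T K).filter fun τ => nstar K < age K t τ) (W := fun K => ∑ n ∈ Ioc (nstar K) K, a n)
    (fun K t _ _ => Finset.filter_subset _ _) (fun K _ => Finset.sum_nonneg fun n _ => ha0 n) (fun K hK => hK₀ K hK) hWs
    (fun K t ht _ => sum_filter_ageCut_le (hage K t ht) (hwtA K t ht)) (fun K t ht _ => sum_filter_ageCut_le (hage K t ht) (hwtB K t ht))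
  have hg : Summable fun K : ℕ => C * θ ^ (K - nstar K) / vol := ((hgeo.mul_left C).div_const vol).congr fun K => by ring
  have hδ : Summable fun K : ℕ => if K₀ ≤ K then C * θ ^ (K - nstar K) / vol else C / vol := by
    refine (summable_nat_add_iff K₀).mp (((summable_nat_add_iff K₀).mpr hg).congr fun n => ?_)
    simp [Nat.le_add_left K₀ n]
  refine ⟨K₀, hybridNE7_noShell hW (fun K t ht τ hτ => (hA K t ht τ hτ).le) (fun K t ht τ hτ => (hB K t ht τ hτ).le) hδ fun K => ?_⟩
  obtain ⟨c, hc⟩ := hdev K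
  refine ⟨c, fun t ht τ hτ => ?_⟩
  have hτT : τ ∈ T K := by
    by_cases hK : K₀ ≤ K
    · simp only [hK, if_true] at hτ; exact (Finset.mem_sdiff.mp hτ).1
    · simp only [hK, if_false, Finset.sdiff_empty] at hτ; exact hτ
  refine sandwich_of_abs_log_sub_le (hA K t ht τ hτT) (hB K t ht τ hτT) ?_
  by_cases hK : K₀ ≤ K
  · simp only [hK, if_true] at hτ ⊢
    have hage' : age K t τ ≤ nstar K := not_lt.mp fun h => (Finset.mem_sdiff.mp hτ).2 (Finset.mem_filter.mpr ⟨hτT, h⟩)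
    rw [mul_div_cancel₀ _ hvol.ne']
    calc |Real.log (B K t τ) - Real.log (A K t τ) - c| ≤ u (K - age K t τ) := hc t ht τ hτT
      _ ≤ C * θ ^ (K - age K t τ) := hu _
      _ ≤ C * θ ^ (K - nstar K) := mul_le_mul_of_nonneg_left (pow_le_pow_of_le_one hθ hθ1 (Nat.sub_le_sub_left hage' K)) hC
  · simp only [hK, if_false]
    rw [mul_div_cancel₀ _ hvol.ne']
    calc |Real.log (B K t τ) - Real.log (A K t τ) - c| ≤ u (K - age K t τ) := hc t ht τ hτT
      _ ≤ C * θ ^ (K - age K t τ) := hu _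
      _ ≤ C * 1 := mul_le_mul_of_nonneg_left (pow_le_one₀ hθ hθ1) hC
      _ = C := mul_one C

/-- **★★ THE HALF-AGE CUT WITH NO SMALLNESS HYPOTHESIS** [folklore]: activity `a ≥ 0` with summable FIRST AGE-MOMENT, birth-scale matching `u j ≤ C·θ^j` (`0 ≤ C`, `0 ≤ θ < 1`),
positive terms with ages `≤ K`, both runs' age-`n` weight fractions `≤ a n`, `0 < vol` ⇒ `∃ K₀, HybridNE7 …` at the fine key with bad class `{age > K∕2}` from `K₀` on. -/
theorem hybridNE7_halfAgeCut_eventually (hvol : 0 < vol) (hC : 0 ≤ C) (hθ : 0 ≤ θ) (hθ1 : θ < 1) (hu : ∀ j, u j ≤ C * θ ^ j)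
    (ha0 : ∀ n, 0 ≤ a n) (ha1 : Summable fun n : ℕ => ((n : ℝ) + 1) * a n)
    (hA : ∀ (K : ℕ) (t : ℝ), |t| ≤ l₀ → ∀ τ ∈ T K, 0 < A K t τ) (hB : ∀ (K : ℕ) (t : ℝ), |t| ≤ l₀ → ∀ τ ∈ T K, 0 < B K t τ)
    (hage : ∀ (K : ℕ) (t : ℝ), |t| ≤ l₀ → ∀ τ ∈ T K, age K t τ ≤ K)
    (hdev : ∀ K : ℕ, ∃ c : ℝ, ∀ t : ℝ, |t| ≤ l₀ → ∀ τ ∈ T K, |Real.log (B K t τ) - Real.log (A K t τ) - c| ≤ u (K - age K t τ))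
    (hwtA : ∀ (K : ℕ) (t : ℝ), |t| ≤ l₀ → ∀ n, ∑ τ ∈ (T K).filter (fun τ => age K t τ = n), A K t τ ≤ a n * ∑ τ ∈ T K, A K t τ)
    (hwtB : ∀ (K : ℕ) (t : ℝ), |t| ≤ l₀ → ∀ n, ∑ τ ∈ (T K).filter (fun τ => age K t τ = n), B K t τ ≤ a n * ∑ τ ∈ T K, B K t τ) :
    ∃ K₀ : ℕ, HybridNE7 l₀ vol T A B (fun K t => if K₀ ≤ K then (T K).filter (fun τ => K / 2 < age K t τ) else ∅)
      (Set.indicator {K | K₀ ≤ K} fun K => ∑ n ∈ Ioc (K / 2) K, a n) (fun _ _ _ => 0) (fun _ _ _ => 0) (fun _ => 0)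
      (fun K => if K₀ ≤ K then C * θ ^ (K - K / 2) / vol else C / vol) :=
  hybridNE7_ageCut_eventually (nstar := fun K => K / 2) hvol hC hθ hθ1.le hu (summable_pow_sub_half hθ hθ1) ha0 (summable_halfAgeTail ha0 ha1) hA hB hage hdev hwtA hwtB

end Eventually



/-! ## §7 (v1.1, append-only) The WINDOW-ROAD junction: a class-uniform summable gap on the kept terms [folklore]

The crux idea card `window-key-core` (idea-3 g8; CRIT-1 triage `Cruxes/…/CRIT-1-TRIAGE-window-key-core.md`) keys the reading to Bałaban's (1.80) pending WINDOW and budgets the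
kept terms' two-run gap by a CLASS-UNIFORM per-volume letter `gap K ≤ windowBudget …` ((YG)), summable under its `FractionCondition` (dag-n20-w3 g5 `…N20WindowKeyBudget`), while
the over-aged terms are booked by N20's weight ((AC)).  The junction to stub 2's N19′ ∧ N20 conjuncts is §4 with the birth-scale letter `u` replaced by that class-uniform gap. -/

section Window
variable [DecidableEq ι] {l₀ vol : ℝ} {T : ℕ → Finset ι} {A B : ℕ → ℝ → ι → ℝ} {age : ℕ → ℝ → ι → ℕ} {g a : ℕ → ℝ} {nstar : ℕ → ℕ}

/-- **`Core` ON THE KEPT TERMS FROM A CLASS-UNIFORM GAP** [folklore]: positive terms and, for every `K`, ONE constant `c_K` with `|log B − log A − c_K| ≤ vol·g K` on every term KEPT by the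
cut (`age ≤ n⋆ K`) ⇒ `Core l₀ vol T {age > n⋆} A B g` (`NE7.sandwich_of_abs_log_sub_le`).  The window road's (YG) letter is this hypothesis with `g := gap`. -/
theorem core_ageCut_of_gap
    (hA : ∀ (K : ℕ) (t : ℝ), |t| ≤ l₀ → ∀ τ ∈ T K, 0 < A K t τ) (hB : ∀ (K : ℕ) (t : ℝ), |t| ≤ l₀ → ∀ τ ∈ T K, 0 < B K t τ)
    (hgap : ∀ K : ℕ, ∃ c : ℝ, ∀ t : ℝ, |t| ≤ l₀ → ∀ τ ∈ T K, age K t τ ≤ nstar K → |Real.log (B K t τ) - Real.log (A K t τ) - c| ≤ vol * g K) :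
    Core l₀ vol T (fun K t => (T K).filter fun τ => nstar K < age K t τ) A B g := by
  intro K
  obtain ⟨c, hc⟩ := hgap K
  refine ⟨c, fun t ht τ hτ => ?_⟩
  obtain ⟨hτT, hτB⟩ := Finset.mem_sdiff.mp hτ
  have hage : age K t τ ≤ nstar K := not_lt.mp fun h => hτB (Finset.mem_filter.mpr ⟨hτT, h⟩)
  exact sandwich_of_abs_log_sub_le (hA K t ht τ hτT) (hB K t ht τ hτT) (hc t ht τ hτT hage)

/-- **★★ THE WINDOW-ROAD JUNCTION** [folklore]: NE7b from the activity letters for the over-aged terms (§2: `a ≥ 0`, tail `< 1` and summable, both runs' age-`n` weight fractions `≤ a n`,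
ages `≤ K`) + a class-uniform SUMMABLE per-volume gap `g` on the kept terms ⇒ `HybridNE7 l₀ vol T A B {age > n⋆} (K ↦ Σ_{Ioc (n⋆ K) K} a n) 0 0 0 g` — stub 2's N19′ ∧ N20 conjuncts at
the WINDOW key with zero shells, from (YG) + (AC)-type letters; with `g := windowBudget …` summable by dag-n20-w3's `summable_windowBudget_of_fraction` under the `FractionCondition`. -/
theorem hybridNE7_ageCut_of_gap (hg : Summable g)
    (ha0 : ∀ n, 0 ≤ a n) (hW1 : ∀ K, ∑ n ∈ Ioc (nstar K) K, a n < 1) (hWs : Summable fun K => ∑ n ∈ Ioc (nstar K) K, a n)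
    (hA : ∀ (K : ℕ) (t : ℝ), |t| ≤ l₀ → ∀ τ ∈ T K, 0 < A K t τ) (hB : ∀ (K : ℕ) (t : ℝ), |t| ≤ l₀ → ∀ τ ∈ T K, 0 < B K t τ)
    (hage : ∀ (K : ℕ) (t : ℝ), |t| ≤ l₀ → ∀ τ ∈ T K, age K t τ ≤ K)
    (hgap : ∀ K : ℕ, ∃ c : ℝ, ∀ t : ℝ, |t| ≤ l₀ → ∀ τ ∈ T K, age K t τ ≤ nstar K → |Real.log (B K t τ) - Real.log (A K t τ) - c| ≤ vol * g K)
    (hwtA : ∀ (K : ℕ) (t : ℝ), |t| ≤ l₀ → ∀ n, ∑ τ ∈ (T K).filter (fun τ => age K t τ = n), A K t τ ≤ a n * ∑ τ ∈ T K, A K t τ)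
    (hwtB : ∀ (K : ℕ) (t : ℝ), |t| ≤ l₀ → ∀ n, ∑ τ ∈ (T K).filter (fun τ => age K t τ = n), B K t τ ≤ a n * ∑ τ ∈ T K, B K t τ) :
    HybridNE7 l₀ vol T A B (fun K t => (T K).filter fun τ => nstar K < age K t τ) (fun K => ∑ n ∈ Ioc (nstar K) K, a n)
      (fun _ _ _ => 0) (fun _ _ _ => 0) (fun _ => 0) g :=
  hybridNE7_noShell (relWeightBound_ageCut ha0 hW1 hWs hage hwtA hwtB) (fun K t ht τ hτ => (hA K t ht τ hτ).le) (fun K t ht τ hτ => (hB K t ht τ hτ).le)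
    hg (core_ageCut_of_gap hA hB hgap)

/-- … and WITHOUT the smallness hypothesis (§6's device): from the first `K₀` after which the summable tail stays below `1`, with ALL terms matched at a finite per-volume radius `R K` before
`K₀` (`|log B − log A − c_K| ≤ vol·R K` on all of `T K`). [folklore] -/
theorem hybridNE7_ageCut_of_gap_eventually {R : ℕ → ℝ} (hg : Summable g)
    (ha0 : ∀ n, 0 ≤ a n) (hWs : Summable fun K => ∑ n ∈ Ioc (nstar K) K, a n)
    (hA : ∀ (K : ℕ) (t : ℝ), |t| ≤ l₀ → ∀ τ ∈ T K, 0 < A K t τ) (hB : ∀ (K : ℕ) (t : ℝ), |t| ≤ l₀ → ∀ τ ∈ T K, 0 < B K t τ)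
    (hage : ∀ (K : ℕ) (t : ℝ), |t| ≤ l₀ → ∀ τ ∈ T K, age K t τ ≤ K)
    (hgap : ∀ K : ℕ, ∃ c : ℝ, ∀ t : ℝ, |t| ≤ l₀ → ∀ τ ∈ T K,
      (age K t τ ≤ nstar K → |Real.log (B K t τ) - Real.log (A K t τ) - c| ≤ vol * g K) ∧ |Real.log (B K t τ) - Real.log (A K t τ) - c| ≤ vol * R K)
    (hwtA : ∀ (K : ℕ) (t : ℝ), |t| ≤ l₀ → ∀ n, ∑ τ ∈ (T K).filter (fun τ => age K t τ = n), A K t τ ≤ a n * ∑ τ ∈ T K, A K t τ)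
    (hwtB : ∀ (K : ℕ) (t : ℝ), |t| ≤ l₀ → ∀ n, ∑ τ ∈ (T K).filter (fun τ => age K t τ = n), B K t τ ≤ a n * ∑ τ ∈ T K, B K t τ) :
    ∃ K₀ : ℕ, HybridNE7 l₀ vol T A B (fun K t => if K₀ ≤ K then (T K).filter (fun τ => nstar K < age K t τ) else ∅)
      (Set.indicator {K | K₀ ≤ K} fun K => ∑ n ∈ Ioc (nstar K) K, a n) (fun _ _ _ => 0) (fun _ _ _ => 0) (fun _ => 0)
      (fun K => if K₀ ≤ K then g K else R K) := by
  obtain ⟨K₀, hK₀⟩ := Filter.eventually_atTop.mp (hWs.tendsto_atTop_zero.eventually (gt_mem_nhds one_pos))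
  have hW := T4WeightBudget.relWeightBound_of_eventually (l₀ := l₀) (T := T) (A := A) (B := B) (K₀ := K₀)
    (Bad := fun K t => (T K).filter fun τ => nstar K < age K t τ) (W := fun K => ∑ n ∈ Ioc (nstar K) K, a n)
    (fun K t _ _ => Finset.filter_subset _ _) (fun K _ => Finset.sum_nonneg fun n _ => ha0 n) (fun K hK => hK₀ K hK) hWs
    (fun K t ht _ => sum_filter_ageCut_le (hage K t ht) (hwtA K t ht)) (fun K t ht _ => sum_filter_ageCut_le (hage K t ht) (hwtB K t ht))
  have hδ : Summable fun K : ℕ => if K₀ ≤ K then g K else R K := by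
    refine (summable_nat_add_iff K₀).mp (((summable_nat_add_iff K₀).mpr hg).congr fun n => ?_)
    simp [Nat.le_add_left K₀ n]
  refine ⟨K₀, hybridNE7_noShell hW (fun K t ht τ hτ => (hA K t ht τ hτ).le) (fun K t ht τ hτ => (hB K t ht τ hτ).le) hδ fun K => ?_⟩
  obtain ⟨c, hc⟩ := hgap K
  refine ⟨c, fun t ht τ hτ => ?_⟩
  have hτT : τ ∈ T K := by
    by_cases hK : K₀ ≤ K
    · simp only [hK, if_true] at hτ; exact (Finset.mem_sdiff.mp hτ).1
    · simp only [hK, if_false, Finset.sdiff_empty] at hτ; exact hτ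
  refine sandwich_of_abs_log_sub_le (hA K t ht τ hτT) (hB K t ht τ hτT) ?_
  by_cases hK : K₀ ≤ K
  · simp only [hK, if_true] at hτ ⊢
    have hage' : age K t τ ≤ nstar K := not_lt.mp fun h => (Finset.mem_sdiff.mp hτ).2 (Finset.mem_filter.mpr ⟨hτT, h⟩)
    exact (hc t ht τ hτT).1 hage'
  · simp only [hK, if_false]
    exact (hc t ht τ hτT).2

end Window

end Summit.QuantumFields.YangMills.BalabanUVNodes.N19AgeCutRoad

end
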